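import Literature.AlgebraicGeometry.Motives.HodgeStructureNoExoticClassesLowDegree
import HarnessLib

/-!
# Hodge classes and divisor classes are detected after wedging with powers of `E`; exotic Hodge classes propagate towards the
# middle degree: `b_p - d_p ≤ b_{p'} - d_{p'}` for `p ≤ p' ≤ g - p`, and there are no exotic classes at all iff there are none
# in the middle degree `2⌊g/2⌋`

[topic AlgebraicGeometry/Motives]

Layer `Literature/AlgebraicGeometry/Motives`, lane `lit-hodgefound` (Track 2 foundations library; prover seat `lit-hodgefound-p34`,
generation 28, row g28-#10). THEOREMS ONLY (no `def`, no named fact, no instance, no notation; net debt `0`). Sequel of the seat's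
g28-#7 (`Lʲ` on `Bᵖ`: `map_lefschetzPow_hodgeClasses_le`, `mem_hodgeClasses_of_lefschetzPow_mem` in the bijective range), g28-#8
(`Polarization.mem_divisorClasses_of_lefschetzPow_mem`: descent of divisor classes along `Lʲ`) and g28-#9 (complementary degrees,
reduction to `2p ≤ g`).

## The sources, verbatim

P. Deligne, *Hodge cycles on abelian varieties* [Deligne1982HodgeCycles], I §2, 2.1 (c): "The class `x` is an absolute Hodge cycle if and
only if `γ^{d-2p} · x` is an absolute Hodge cycle." J. S. Milne, *Lefschetz classes on abelian varieties* (1999) [Milne1999LefschetzClasses],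
p. 660: "we say that a Hodge class is *exotic* if it is not Lefschetz"; §4 Cor. 4.5 (`H^{2p}(A)^{S(A)} = Dᵖ(A)`), §5 Prop. 5.2. B. Moonen,
Yu. Zarhin, *Hodge classes on abelian varieties of low dimension* (1999) [MoonenZarhin1999LowDim], §1: "Hodge classes which do not lie in
`D•(X)` are called exceptional Hodge classes." H. Lange, *Abelian Varieties over the Complex Numbers* (2023) [Lange2023AbelianVarietiesComplex],
§7.3.2 (1): "`L^{g-k} : ⋀ᵏV → ⋀^{2g-k}V` is an isomorphism of `Sp(V, E)`-representations".

## Reading on the carrier, and what is PROVED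

`H` a `ℚ`-Hodge structure of odd weight `n` on `V`, `dim V = 2g`, `Q` a polarization, `E = E_Q`, `Lʲ = Eʲ ∧ ·`; `Bᵖ = Hdg^{pn}(⋀^{2p} H) ⊇ Dᵖ`,
`b_p ≥ d_p`, `e_p = b_p - d_p` the number of independent exotic (exceptional) classes in degree `2p`.

* **`Polarization.lefschetzPow_mem_hodgeClasses_iff`** — for `k + j ≤ g`, `x ∈ ⋀ᵏ V` is a Hodge class iff `Eʲ ∧ x` is (Deligne's 2.1 (c)
  below the middle: compose with `L^{g-k-j}` into the bijective range).
* **`Polarization.lefschetzPow_mem_divisorClasses_iff`** — for `2p + j ≤ g`, `x` is a divisor class iff `Eʲ ∧ x` is;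
  `Polarization.map_lefschetzPow_hodgeClasses_inf_divisorClasses` (`Lʲ(Bᵖ) ∩ D^{p+j} = Lʲ(Dᵖ)`).
* `Polarization.finrank_hodgeClasses_add_finrank_divisorClasses_le` (`b_p + d_{p'} ≤ b_{p'} + d_p`) and
  **`Polarization.finrank_hodgeClasses_sub_finrank_divisorClasses_mono`: `e_p ≤ e_{p'}` for `p ≤ p'`, `p + p' ≤ g`** — EXOTIC CLASSES
  PROPAGATE TOWARDS THE MIDDLE (`Lʲ` embeds `Bᵖ/Dᵖ` into `B^{p'}/D^{p'}`); `Polarization.divisorClasses_eq_hodgeClasses_of_le_of_add_le`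
  (`D^{p'} = B^{p'} ⟹ Dᵖ = Bᵖ`), `Polarization.divisorClasses_ne_hodgeClasses_of_le_of_add_le` (an exotic class in degree `2p` forces one
  in every degree `2p'`, `p ≤ p' ≤ g - p`).
* **`Polarization.forall_divisorClasses_eq_hodgeClasses_iff_half` — NO EXOTIC CLASSES AT ALL ⟺ NONE IN THE MIDDLE DEGREE `2⌊g/2⌋`**;
  `Polarization.finrank_hodgeClasses_sub_finrank_divisorClasses_le_half` (`e_p ≤ e_{⌊g/2⌋}` for every `p`: the middle degree carries the
  most exotic classes).

## References

* [Deligne1982HodgeCycles] P. Deligne, *Hodge cycles on abelian varieties*, LNM 900 (1982), I §2, 2.1 (c).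
* [Milne1999LefschetzClasses] J. S. Milne, *Lefschetz classes on abelian varieties*, Duke Math. J. 96 (1999), p. 660, §4 Cor. 4.5, §5 Prop. 5.2.
* [MoonenZarhin1999LowDim] B. Moonen, Yu. Zarhin, *Hodge classes on abelian varieties of low dimension*, Math. Ann. 315 (1999), §1.
* [Lange2023AbelianVarietiesComplex] H. Lange, *Abelian Varieties over the Complex Numbers* (2023), §7.3.2 (1)–(3) (p. 338).
-/

noncomputable section

namespace Literature.AlgebraicGeometry.Motives.HodgeStructure

open ExteriorLefschetz ExteriorAlgebra

universe u

variable {V : Type u} [AddCommGroup V] [Module ℚ V] [Module.Finite ℚ V] {n : ℤ} {H : HodgeStructure V n}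
  (Q : Polarization H) (hn : Odd n) {g : ℕ} (hg : Module.finrank ℚ V = 2 * g)

/-! ## §1 Detection after wedging with `Eʲ` -/

include hn hg in
/-- **`x ∈ ⋀ᵏ V` is a Hodge class iff `Eʲ ∧ x` is, for `k + j ≤ g`** (Deligne's 2.1 (c) below the middle: `L^{g-k-j}(Eʲ ∧ x) = E^{g-k} ∧ x`
lands in the bijective range). [cite: Deligne1982HodgeCycles, I §2, 2.1 (c)] [cite: Lange2023AbelianVarietiesComplex, §7.3.2 (1) (p. 338)] -/
theorem Polarization.lefschetzPow_mem_hodgeClasses_iff {k j m : ℕ} (hkj : k + j ≤ g) (h : 2 * j + k = m) {q : ℤ} {x : ⋀[ℚ]^k V} :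
    lefschetzPow (Q.lefschetzClass : ExteriorAlgebra ℚ V) Q.lefschetzClass.2 j h x ∈ (H.exteriorPower m).hodgeClasses (q + j * n) ↔
      x ∈ (H.exteriorPower k).hodgeClasses q := by
  refine ⟨fun hy ↦ ?_, fun hx ↦ lefschetzPow_mem_hodgeClasses H Q.lefschetzClass_mem_hodgeClasses j h hx⟩
  have h' : 2 * (g - k - j) + m = 2 * g - k := by omega
  have h'' : 2 * (j + (g - k - j)) + k = 2 * g - k := by omega
  have hy' := lefschetzPow_mem_hodgeClasses H Q.lefschetzClass_mem_hodgeClasses (g - k - j) h' hy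
  rw [lefschetzPow_lefschetzPow Q.lefschetzClass.2 j (g - k - j) h h' h'', add_assoc, ← add_mul, ← Nat.cast_add] at hy'
  exact mem_hodgeClasses_of_lefschetzPow_mem H Q.lefschetzClass_mem_hodgeClasses (Q.isSymplectic_lefschetzClass hn hg) (by omega) h'' hy'

include hn hg in
/-- **`x ∈ ⋀^{2p} V` is a divisor class iff `Eʲ ∧ x` is, for `2p + j ≤ g`** (`D•` is a ring containing `E`; conversely descent along `Lʲ`,
Milne's Cor. 4.5). [cite: Milne1999LefschetzClasses, §4 Cor. 4.5 and §5 Prop. 5.2] [cite: Lange2023AbelianVarietiesComplex, §7.3.2 (1) (p. 338)] -/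
theorem Polarization.lefschetzPow_mem_divisorClasses_iff {p j q : ℕ} (hpj : 2 * p + j ≤ g) (h : 2 * j + 2 * p = 2 * q) {x : ⋀[ℚ]^(2 * p) V} :
    lefschetzPow (Q.lefschetzClass : ExteriorAlgebra ℚ V) Q.lefschetzClass.2 j h x ∈ H.divisorClasses q ↔ x ∈ H.divisorClasses p :=
  ⟨Q.mem_divisorClasses_of_lefschetzPow_mem hn hg hpj h,
    fun hx ↦ map_lefschetzPow_divisorClasses_le H Q.lefschetzClass_mem_hodgeClasses j h ⟨x, hx, rfl⟩⟩

include hn hg in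
/-- **`Lʲ(Bᵖ) ∩ D^q = Lʲ(Dᵖ)` (`2p + j ≤ g`, `q = p + j`)**: among the images of Hodge classes, the divisor classes are exactly the images of
divisor classes. [cite: Milne1999LefschetzClasses, §4 Cor. 4.5 and §5 Prop. 5.2] -/
theorem Polarization.map_lefschetzPow_hodgeClasses_inf_divisorClasses {p j q : ℕ} (hpj : 2 * p + j ≤ g) (h : 2 * j + 2 * p = 2 * q) :
    ((H.exteriorPower (2 * p)).hodgeClasses (p * n)).map (lefschetzPow (Q.lefschetzClass : ExteriorAlgebra ℚ V) Q.lefschetzClass.2 j h) ⊓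
        H.divisorClasses q =
      (H.divisorClasses p).map (lefschetzPow (Q.lefschetzClass : ExteriorAlgebra ℚ V) Q.lefschetzClass.2 j h) := by
  refine le_antisymm ?_ (le_inf (Submodule.map_mono (divisorClasses_le_hodgeClasses H p))
    (map_lefschetzPow_divisorClasses_le H Q.lefschetzClass_mem_hodgeClasses j h))
  rintro _ ⟨⟨x, -, rfl⟩, hy⟩
  exact ⟨x, (Q.lefschetzPow_mem_divisorClasses_iff hn hg hpj h).1 hy, rfl⟩

/-! ## §2 Exotic classes propagate towards the middle -/

include Q hn hg in
/-- **`b_p + d_{p'} ≤ b_{p'} + d_p` for `p ≤ p'`, `p + p' ≤ g`**: `L^{p'-p}(Bᵖ) + D^{p'} ⊆ B^{p'}` has dimension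
`b_p + d_{p'} - dim(L^{p'-p}(Bᵖ) ∩ D^{p'}) = b_p + d_{p'} - d_p`. [cite: Milne1999LefschetzClasses, §5 Prop. 5.2 and p. 660]
[cite: Deligne1982HodgeCycles, I §2, 2.1 (c)] -/
theorem Polarization.finrank_hodgeClasses_add_finrank_divisorClasses_le {p p' : ℕ} (hpp' : p ≤ p') (hs : p + p' ≤ g) :
    Module.finrank ℚ ↥((H.exteriorPower (2 * p)).hodgeClasses (p * n)) + Module.finrank ℚ ↥(H.divisorClasses p') ≤
      Module.finrank ℚ ↥((H.exteriorPower (2 * p')).hodgeClasses (p' * n)) + Module.finrank ℚ ↥(H.divisorClasses p) := by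
  have h : 2 * (p' - p) + 2 * p = 2 * p' := by omega
  have hinj := (Q.isSymplectic_lefschetzClass hn hg).lefschetzPow_injective (k := 2 * p) (j := p' - p) (by omega) h
  set L := lefschetzPow (Q.lefschetzClass : ExteriorAlgebra ℚ V) Q.lefschetzClass.2 (p' - p) h with hL
  have hB : Module.finrank ℚ ↥(((H.exteriorPower (2 * p)).hodgeClasses (p * n)).map L) =
      Module.finrank ℚ ↥((H.exteriorPower (2 * p)).hodgeClasses (p * n)) :=
    (LinearEquiv.finrank_eq (Submodule.equivMapOfInjective L hinj _)).symm
  have hD : Module.finrank ℚ ↥((H.divisorClasses p).map L) = Module.finrank ℚ ↥(H.divisorClasses p) :=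
    (LinearEquiv.finrank_eq (Submodule.equivMapOfInjective L hinj _)).symm
  have hinf := Q.map_lefschetzPow_hodgeClasses_inf_divisorClasses hn hg (p := p) (j := p' - p) (q := p') (by omega) h
  have hsup : ((H.exteriorPower (2 * p)).hodgeClasses (p * n)).map L ⊔ H.divisorClasses p' ≤
      (H.exteriorPower (2 * p')).hodgeClasses (p' * n) := by
    refine sup_le ?_ (divisorClasses_le_hodgeClasses H p')
    have hle := map_lefschetzPow_hodgeClasses_le H Q.lefschetzClass_mem_hodgeClasses (p' - p) h ((p : ℤ) * n)
    rwa [show (p : ℤ) * n + ((p' - p : ℕ) : ℤ) * n = (p' : ℤ) * n by rw [Nat.cast_sub hpp']; ring] at hle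
  have key := Submodule.finrank_sup_add_finrank_inf_eq (((H.exteriorPower (2 * p)).hodgeClasses (p * n)).map L) (H.divisorClasses p')
  rw [hinf, hB, hD] at key
  have := Submodule.finrank_mono hsup
  omega

include Q hn hg in
/-- **EXOTIC CLASSES PROPAGATE TOWARDS THE MIDDLE: `b_p - d_p ≤ b_{p'} - d_{p'}` for `p ≤ p'`, `p + p' ≤ g`** (`L^{p'-p}` embeds `Bᵖ/Dᵖ` into
`B^{p'}/D^{p'}`). [cite: Milne1999LefschetzClasses, p. 660 and §5 Prop. 5.2] [cite: MoonenZarhin1999LowDim, §1] -/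
theorem Polarization.finrank_hodgeClasses_sub_finrank_divisorClasses_mono {p p' : ℕ} (hpp' : p ≤ p') (hs : p + p' ≤ g) :
    Module.finrank ℚ ↥((H.exteriorPower (2 * p)).hodgeClasses (p * n)) - Module.finrank ℚ ↥(H.divisorClasses p) ≤
      Module.finrank ℚ ↥((H.exteriorPower (2 * p')).hodgeClasses (p' * n)) - Module.finrank ℚ ↥(H.divisorClasses p') := by
  have h1 := Q.finrank_hodgeClasses_add_finrank_divisorClasses_le hn hg hpp' hs
  have h2 := Submodule.finrank_mono (divisorClasses_le_hodgeClasses H p')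
  omega

include Q hn hg in
/-- **No exotic classes in degree `2p'` ⟹ none in degree `2p`, for `p ≤ p' ≤ g - p`.** [cite: Milne1999LefschetzClasses, p. 660 and §5 Prop. 5.2]
[cite: Deligne1982HodgeCycles, I §2, 2.1 (c)] -/
theorem Polarization.divisorClasses_eq_hodgeClasses_of_le_of_add_le {p p' : ℕ} (hpp' : p ≤ p') (hs : p + p' ≤ g)
    (h' : H.divisorClasses p' = (H.exteriorPower (2 * p')).hodgeClasses (p' * n)) :
    H.divisorClasses p = (H.exteriorPower (2 * p)).hodgeClasses (p * n) := by
  have h1 := Q.finrank_hodgeClasses_add_finrank_divisorClasses_le hn hg hpp' hs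
  have h2 := Submodule.finrank_mono (divisorClasses_le_hodgeClasses H p)
  rw [h'] at h1
  exact Submodule.eq_of_le_of_finrank_eq (divisorClasses_le_hodgeClasses H p) (by omega)

include Q hn hg in
/-- **An exotic class in degree `2p` forces exotic classes in every degree `2p'`, `p ≤ p' ≤ g - p`.**
[cite: Milne1999LefschetzClasses, p. 660 and §5 Prop. 5.2] [cite: MoonenZarhin1999LowDim, §1] -/
theorem Polarization.divisorClasses_ne_hodgeClasses_of_le_of_add_le {p p' : ℕ} (hpp' : p ≤ p') (hs : p + p' ≤ g)
    (hne : H.divisorClasses p ≠ (H.exteriorPower (2 * p)).hodgeClasses (p * n)) :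
    H.divisorClasses p' ≠ (H.exteriorPower (2 * p')).hodgeClasses (p' * n) :=
  fun h' ↦ hne (Q.divisorClasses_eq_hodgeClasses_of_le_of_add_le hn hg hpp' hs h')

/-! ## §3 The middle degree decides -/

include Q hn hg in
/-- **NO EXOTIC CLASSES AT ALL ⟺ NONE IN THE MIDDLE DEGREE `2⌊g/2⌋`** (every degree `2p ≤ g` propagates to `2⌊g/2⌋`; the degrees above
the middle are complementary, g28-#9). [cite: Milne1999LefschetzClasses, p. 660 and §5 Prop. 5.2] [cite: Deligne1982HodgeCycles, I §2, 2.1 (c)]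
[cite: MoonenZarhin1999LowDim, §1] -/
theorem Polarization.forall_divisorClasses_eq_hodgeClasses_iff_half :
    (∀ p : ℕ, H.divisorClasses p = (H.exteriorPower (2 * p)).hodgeClasses (p * n)) ↔
      H.divisorClasses (g / 2) = (H.exteriorPower (2 * (g / 2))).hodgeClasses ((g / 2 : ℕ) * n) :=
  ⟨fun h ↦ h (g / 2), fun hmid ↦ Q.divisorClasses_eq_hodgeClasses_of_forall_two_mul_le hn hg fun p hp ↦
    Q.divisorClasses_eq_hodgeClasses_of_le_of_add_le hn hg (p' := g / 2) (by omega) (by omega) hmid⟩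

include Q hn hg in
/-- **`e_p ≤ e_{⌊g/2⌋}` for every `p`: the middle degree carries the most exotic classes** (propagation below the middle, complementary
degrees above it, nothing beyond `2g`). [cite: Milne1999LefschetzClasses, p. 660 and §5 Prop. 5.2] [cite: Deligne1982HodgeCycles, I §2, 2.1 (c)] -/
theorem Polarization.finrank_hodgeClasses_sub_finrank_divisorClasses_le_half (p : ℕ) :
    Module.finrank ℚ ↥((H.exteriorPower (2 * p)).hodgeClasses (p * n)) - Module.finrank ℚ ↥(H.divisorClasses p) ≤
      Module.finrank ℚ ↥((H.exteriorPower (2 * (g / 2))).hodgeClasses ((g / 2 : ℕ) * n)) -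
        Module.finrank ℚ ↥(H.divisorClasses (g / 2)) := by
  by_cases h1 : 2 * p ≤ g
  · exact Q.finrank_hodgeClasses_sub_finrank_divisorClasses_mono hn hg (by omega) (by omega)
  by_cases h2 : p ≤ g
  · rw [← Q.finrank_hodgeClasses_sub_finrank_divisorClasses_eq hn hg (p := g - p) (q := p) (by omega) (by omega)]
    exact Q.finrank_hodgeClasses_sub_finrank_divisorClasses_mono hn hg (by omega) (by omega)
  · rw [finrank_hodgeClasses_exteriorPower_eq_zero_of_finrank_lt H (by omega), Nat.zero_sub]
    exact Nat.zero_le _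

end Literature.AlgebraicGeometry.Motives.HodgeStructure

end
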